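import Summits.QuantumFields.GaugeBoot.Certificates.SparseReducedWindow
import Summits.QuantumFields.GaugeBoot.Certificates.KZL2rpD3b9o2UpDA
import HarnessLib

/-!
# Kernel replay of the certsdp certificate `kzL2_D3_b9o2_max_rp_G2` — part G: factor-row assembly and objective (gb_lean_emit_win 0.10.1)

HONEST FRAMING (cell `pub-gaugeboot`): certified bounds on lattice expectations at stated coupling,
gauge group, dimension and torus size; NOT a mass gap, NOT a continuum limit, NOT a string tension;
NOT Yang–Mills-summit-bearing (barriers `FixedCouplingUltralocality`, `PerturbativeInvisibility`).

Certificate sha256 `b7541160304b378f2ec0d2ef5839b28e562008d7f3f1dcd8de165f5aab1428d4` (problem `kzL2_D3_b9o2_max_rp_G2`, sha256 `ca4b3fd15aa3ee78ab6c2acd8ff5283ee2af6fc8d5ecf7ab79d05221022a8dc6`): `GB` = all factor rows (data parts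
`Certificates/KZL2rpD3b9o2UpD….lean` concatenated), the INTEGER objective row `cZ`, the certified bound `lowerQ`, and the kernel check
`gb_len` (factor rows fit the padded dimension 38). Windows: `Certificates/KZL2rpD3b9o2UpA….lean`; assembly + theorems: `Certificates/KZL2rpD3b9o2Up.lean`.
Data/plumbing only; nothing is claimed about lattice gauge theory in this file.
-/

namespace Summit.QuantumFields.GaugeBoot.Certificates.KZL2rpD3b9o2Up

noncomputable section

open Summit.QuantumFields.GaugeBoot.Certificates.Sparse

/-- All factor rows (concatenation of the data parts' block lists). -/
def GB : List (List (List ℤ)) := GBa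

/-- Objective as a sparse INTEGER row: (-1)·y_1. -/
def cZ : List (ℕ × ℤ) := [(1, Int.negSucc 0)]

/-- The certified lower bound on the objective (exact): `-192147072690835721548022099/244807478471962407878000640` (≈ -0.7848905347589). -/
def lowerQ : ℚ := -192147072690835721548022099/244807478471962407878000640

set_option maxHeartbeats 0 in
/-- Kernel check: every factor row of every block has length `≤ 38`. -/
theorem gb_len : lenCheckAll KZL2rpD3b9o2Up.GB 38 40 = true := by
  decide +kernel

end

end Summit.QuantumFields.GaugeBoot.Certificates.KZL2rpD3b9o2Up
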